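import Summits.Parity.GeneralizedHardyLittlewood.Theorems.PrimeLevelFamEdgeMomentsBeyondDiagonalDiagDecorPrimeSqFourth
import Summits.Parity.GeneralizedHardyLittlewood.Theorems.PrimeLevelFamEdgeMomentsBeyondDiagonalDiagDecorPrimeSqSqPrimeFourth
import Summits.Parity.GeneralizedHardyLittlewood.Theorems.PrimeLevelFamEdgeMomentsBeyondDiagonalDiagDecorPrimePowPair
import HarnessLib

/-!
# Route `PrimeLevelFamEdge`, crux K_A `MomentsBeyondDiagonal` (stmt-Parity-20007), line «petersson_layers» v4, stub `stub_diag`: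
# **THE `M₈`-DECORATED COPRIME SELBERG SUM HAS NO MAIN TERM AT ORDER `log^{c+6}y`:
# `|Σ_{k≤y,(k,n)=1}τ(k)W(k)·(105P₂⁴ − 420P₂²P₄ + 448P₂P₆ + 140P₄² − 272P₈)(k)·logᶜ(y/k)| ≤ C·D(n)(1+κ(n))(1+log y)^{c+5}`** (`c ≥ 2`)

The arithmetic core of the `M₈`-engine for order `(4,4)` of `stub_diag` (`M₈ = τ(105P₂⁴ − 420P₂²P₄ + 448P₂P₆ + 140P₄² − 272P₈)`
on squarefree numbers, `…DiagDecorWeightRungFour.centralMoment_eight_of_squarefree`), exactly as `…DiagDecorM4Coprime` /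
`…DiagDecorM6Coprime`: the five families are `P₂⁴ ↦ −8000` (`…DiagDecorPrimeSqFourth`), `P₂²P₄ ↦ −9024`
(`…DiagDecorPrimeSqSqPrimeFourth`), `P₂P₆ ↦ −9600`, `P₄² ↦ −9936` (`…DiagDecorPrimePowPair` at `(1,5)`, `(3,3)`), `P₈ ↦ −10080`
(`…DiagDecorPrimePowTwo … 7`) in units `c!/(c+6)!·E_n log^{c+6}y`, and `105·8000 − 420·9024 + 448·9600 + 140·9936 − 272·10080 = 0`.

* `m8_cancellation` — the coefficient identity (in the closed factorial forms the five inputs deliver);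
* `abs_coprimeSumPow_M8_le` — **the displayed bound**.

From here the `M₈` analogues of `…DiagDecorM6Coord/Collapse/Block/Family` (same proofs, decoration
`105(Σlog²p)⁴ − 420(Σlog²p)²(Σlog⁴p) + 448(Σlog²p)(Σlog⁶p) + 140(Σlog⁴p)² − 272Σlog⁸p`, coordinate `O(D(1+κ)log^{r+5}M)`) give the
`M₈`-family Selberg-form bounds `O(log^{m+4}M)` — the third and last new engine of order `(4,4)`. Def-free; theorems only.
Helper `--supports stmt-Parity-20007`; closes nothing; K_A, K_B and the Parity summit are NOT proved; nothing about Landau–Siegel zeros.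

## References
* E. Kowalski, P. Michel, J. VanderKam, J. reine angew. Math. 526 (2000), (23)–(28) pp. 13–15 and Prop. 5.1 p. 18.
  [cite: KowalskiMichelVanderKam2000, (23)–(28) — derivation (eighth central divisor-log moment of the Selberg coordinates)]
-/

noncomputable section

open scoped Real
open Finset ArithmeticFunction

namespace Summit.Parity.GeneralizedHardyLittlewood.Theorems.MomentsBeyondDiagonal.DiagKernel

open Literature.NumberTheory.LFunctions Literature.NumberTheory.LFunctions.KMV2000
open SelbergCoord (kappa)
open Summit.Parity.GeneralizedHardyLittlewood.Theorems.BeyondDiagonalBeatsQuarter.KernelFormXSq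
  (copTauW mainConst divWeight divWeight_nonneg mainConst_nonneg)

/-- `|105a − 420b + 448c + 140d − 272e| ≤ 105|a| + 420|b| + 448|c| + 140|d| + 272|e|`. [folklore] -/
private theorem abs_comb_five_le (a b c d e : ℝ) :
    |105 * a - 420 * b + 448 * c + 140 * d - 272 * e| ≤ 105 * |a| + 420 * |b| + 448 * |c| + 140 * |d| + 272 * |e| := by
  calc _ ≤ |105 * a - 420 * b + 448 * c + 140 * d| + |272 * e| := abs_sub _ _
    _ ≤ |105 * a - 420 * b + 448 * c| + |140 * d| + |272 * e| := by gcongr; exact abs_add_le _ _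
    _ ≤ |105 * a - 420 * b| + |448 * c| + |140 * d| + |272 * e| := by gcongr; exact abs_add_le _ _
    _ ≤ |105 * a| + |420 * b| + |448 * c| + |140 * d| + |272 * e| := by gcongr; exact abs_sub _ _
    _ = _ := by
        rw [abs_mul, abs_mul, abs_mul, abs_mul, abs_mul, abs_of_pos (by norm_num : (0 : ℝ) < 105),
          abs_of_pos (by norm_num : (0 : ℝ) < 420), abs_of_pos (by norm_num : (0 : ℝ) < 448),
          abs_of_pos (by norm_num : (0 : ℝ) < 140), abs_of_pos (by norm_num : (0 : ℝ) < 272)]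

set_option maxHeartbeats 800000 in
-- one large rational-function identity
/-- **The `M₈` cancellation**: with the leading coefficients `K₄, K₂₄, K₂₆, K₄₄, K₈` of the five families (closed factorial forms
of `…PrimeSqFourth`, `…PrimeSqSqPrimeFourth`, `…PrimePowPair (1,5)`, `…PrimePowPair (3,3)`, `…PrimePowTwo 7`; `= 8000, 9024, 9600,
9936, 10080` in units `c!/(c+6)!`), `105K₄ − 420K₂₄ + 448K₂₆ + 140K₄₄ − 272K₈ = 0` for `c ≥ 2`. [folklore] -/
theorem m8_cancellation {c : ℕ} (hc : 2 ≤ c) :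
    105 * (2 * ((c : ℝ) * ((c : ℝ) - 1)) * (((Nat.factorial 7 : ℕ) : ℝ) * (c - 2).factorial / (c + 6).factorial) -
            (3 * (2 * (2 * ((c : ℝ) * ((c : ℝ) - 1)) * (((Nat.factorial 1 : ℕ) : ℝ) * (c - 2).factorial / (c).factorial)) *
                (((Nat.factorial 5 : ℕ) : ℝ) * (c).factorial / (c + 6).factorial)) +
              3 * (2 * (8 * ((c.factorial : ℝ) / (c + 2).factorial)) *
                (((Nat.factorial 3 : ℕ) : ℝ) * (c + 2).factorial / (c + 6).factorial)) +
              2 * (176 * ((c.factorial : ℝ) / (c + 4).factorial)) *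
                (((Nat.factorial 1 : ℕ) : ℝ) * (c + 4).factorial / (c + 6).factorial))) -
      420 * (2 * ((c : ℝ) * ((c : ℝ) - 1)) * (((Nat.factorial 7 : ℕ) : ℝ) * (c - 2).factorial / (c + 6).factorial) -
            (2 * (2 * ((c : ℝ) * ((c : ℝ) - 1)) * (((Nat.factorial 3 : ℕ) : ℝ) * (c - 2).factorial / (c + 2).factorial)) *
                (((Nat.factorial 3 : ℕ) : ℝ) * (c + 2).factorial / (c + 6).factorial) +
              2 * (2 * ((c : ℝ) * ((c : ℝ) - 1)) * (((Nat.factorial 1 : ℕ) : ℝ) * (c - 2).factorial / (c).factorial)) *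
                (((Nat.factorial 5 : ℕ) : ℝ) * (c).factorial / (c + 6).factorial) +
              2 * (216 * ((c.factorial : ℝ) / (c + 4).factorial)) *
                (((Nat.factorial 1 : ℕ) : ℝ) * (c + 4).factorial / (c + 6).factorial))) +
      448 * (2 * ((c : ℝ) * ((c : ℝ) - 1)) * (((Nat.factorial 7 : ℕ) : ℝ) * (c - 2).factorial / (c + 6).factorial) -
            2 * (2 * ((c : ℝ) * ((c : ℝ) - 1)) * (((Nat.factorial 5 : ℕ) : ℝ) * (c - 2).factorial / (c + 4).factorial)) *
              (((Nat.factorial 1 : ℕ) : ℝ) * (c + 4).factorial / (c + 6).factorial)) +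
      140 * (2 * ((c : ℝ) * ((c : ℝ) - 1)) * (((Nat.factorial 7 : ℕ) : ℝ) * (c - 2).factorial / (c + 6).factorial) -
            2 * (2 * ((c : ℝ) * ((c : ℝ) - 1)) * (((Nat.factorial 3 : ℕ) : ℝ) * (c - 2).factorial / (c + 2).factorial)) *
              (((Nat.factorial 3 : ℕ) : ℝ) * (c + 2).factorial / (c + 6).factorial)) -
      272 * (2 * ((c : ℝ) * ((c : ℝ) - 1)) * (((Nat.factorial 7 : ℕ) : ℝ) * (c - 2).factorial / (c + 6).factorial)) = 0 := by
  obtain ⟨j, rfl⟩ : ∃ j, c = j + 2 := ⟨c - 2, by omega⟩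
  have e1 : j + 2 - 2 = j := by omega
  rw [e1]
  have h2 : ((j + 2).factorial : ℝ) = ((j : ℝ) + 2) * ((j : ℝ) + 1) * j.factorial := by
    have : (j + 2).factorial = (j + 2) * ((j + 1) * j.factorial) := by
      rw [show j + 2 = (j + 1) + 1 by omega, Nat.factorial_succ, Nat.factorial_succ]
    rw [this]; push_cast; ring
  have hF0 : (j.factorial : ℝ) ≠ 0 := by exact_mod_cast Nat.factorial_ne_zero _
  have hF4 : ((j + 2 + 2).factorial : ℝ) ≠ 0 := by exact_mod_cast Nat.factorial_ne_zero _
  have hF6 : ((j + 2 + 4).factorial : ℝ) ≠ 0 := by exact_mod_cast Nat.factorial_ne_zero _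
  have hF8 : ((j + 2 + 6).factorial : ℝ) ≠ 0 := by exact_mod_cast Nat.factorial_ne_zero _
  rw [h2, show Nat.factorial 7 = 5040 from rfl, show Nat.factorial 5 = 120 from rfl,
    show Nat.factorial 3 = 6 from rfl, show Nat.factorial 1 = 1 from rfl]
  push_cast
  field_simp
  ring

/-- **The `M₈`-decorated coprime Selberg sum is `O(D(n)(1+κ(n))(1+log y)^{c+5})`** (`c ≥ 2`): there is `C` with, for all
`n ≥ 1`, `y ≥ 1`, `|Σ_{k≤y} a_n(k)·logᶜ(y/k)·(105P₂⁴ − 420P₂²P₄ + 448P₂P₆ + 140P₄² − 272P₈)(k)| ≤ C·D(n)(1+κ(n))(1+log y)^{c+5}`.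
[cite: KowalskiMichelVanderKam2000, (23)–(28) — derivation] -/
theorem abs_coprimeSumPow_M8_le {c : ℕ} (hc : 2 ≤ c) :
    ∃ C : ℝ, 0 < C ∧ ∀ n : ℕ, n ≠ 0 → ∀ y : ℝ, 1 ≤ y →
      |∑ k ∈ Icc 1 ⌊y⌋₊, copTauW n k * Real.log (y / k) ^ c *
          (105 * (∑ p ∈ k.primeFactors, Real.log p ^ 2) ^ 4 -
            420 * (∑ p ∈ k.primeFactors, Real.log p ^ 2) ^ 2 * (∑ p ∈ k.primeFactors, Real.log p ^ 4) +
            448 * (∑ p ∈ k.primeFactors, Real.log p ^ 2) * (∑ p ∈ k.primeFactors, Real.log p ^ 6) +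
            140 * (∑ p ∈ k.primeFactors, Real.log p ^ 4) ^ 2 -
            272 * ∑ p ∈ k.primeFactors, Real.log p ^ 8)| ≤
        C * divWeight n * (1 + kappa n) * (1 + Real.log y) ^ (c + 5) := by
  obtain ⟨C₄, hC₄, h₄⟩ := abs_coprimeSumPow_primeSqFourth_add_le hc
  obtain ⟨C₂₄, hC₂₄, h₂₄⟩ := abs_coprimeSumPow_primeSqSq_primeFourth_add_le hc
  obtain ⟨C₂₆, hC₂₆, h₂₆⟩ := abs_coprimeSumPow_primePowPair_add_le 1 5 hc
  obtain ⟨C₄₄, hC₄₄, h₄₄⟩ := abs_coprimeSumPow_primePowPair_add_le 3 3 hc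
  obtain ⟨C₈, hC₈, h₈⟩ := abs_coprimeSumPow_primePow_add_le_of_two_le 7 hc
  refine ⟨105 * C₄ + 420 * C₂₄ + 448 * C₂₆ + 140 * C₄₄ + 272 * C₈, by positivity, fun n hn y hy ↦ ?_⟩
  set N := ⌊y⌋₊ with hN
  have hA := h₄ n hn y hy
  have hB := h₂₄ n hn y hy
  have hC := h₂₆ n hn y hy
  have hD := h₄₄ n hn y hy
  have hE := h₈ n hn y hy
  -- normalise the pair and the `P₈` inputs
  have e26a : c + 1 + 5 - 1 = c + 5 := by omega
  have e26b : c + 1 + 5 = c + 6 := by omega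
  have e26c : c - 2 + 5 + 1 = c + 4 := by omega
  rw [show 1 + 1 + 5 = 7 from rfl, e26a, e26b, e26c, show ((1 : ℕ) + 1) = 2 from rfl,
    show ((5 : ℕ) + 1) = 6 from rfl] at hC
  have e44a : c + 3 + 3 - 1 = c + 5 := by omega
  have e44b : c + 3 + 3 = c + 6 := by omega
  have e44c : c - 2 + 3 + 1 = c + 2 := by omega
  rw [show 3 + 1 + 3 = 7 from rfl, e44a, e44b, e44c, show ((3 : ℕ) + 1) = 4 from rfl] at hD
  have e8a : c - 2 + 7 + 1 = c + 6 := by omega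
  have e8b : c - 2 + 7 = c + 5 := by omega
  rw [show ((7 : ℕ) + 1) = 8 from rfl, e8a, e8b] at hE
  have hid := m8_cancellation hc
  -- linear decomposition of the `M₈` sum
  have hlin : ∑ k ∈ Icc 1 N, copTauW n k * Real.log (y / k) ^ c *
          (105 * (∑ p ∈ k.primeFactors, Real.log p ^ 2) ^ 4 -
            420 * (∑ p ∈ k.primeFactors, Real.log p ^ 2) ^ 2 * (∑ p ∈ k.primeFactors, Real.log p ^ 4) +
            448 * (∑ p ∈ k.primeFactors, Real.log p ^ 2) * (∑ p ∈ k.primeFactors, Real.log p ^ 6) +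
            140 * (∑ p ∈ k.primeFactors, Real.log p ^ 4) ^ 2 -
            272 * ∑ p ∈ k.primeFactors, Real.log p ^ 8) =
      105 * ∑ k ∈ Icc 1 N, copTauW n k * Real.log (y / k) ^ c * (∑ p ∈ k.primeFactors, Real.log p ^ 2) ^ 4 -
        420 * ∑ k ∈ Icc 1 N, copTauW n k * Real.log (y / k) ^ c *
          ((∑ p ∈ k.primeFactors, Real.log p ^ 2) ^ 2 * ∑ p ∈ k.primeFactors, Real.log p ^ 4) +
        448 * ∑ k ∈ Icc 1 N, copTauW n k * Real.log (y / k) ^ c *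
          ((∑ p ∈ k.primeFactors, Real.log p ^ 2) * ∑ p ∈ k.primeFactors, Real.log p ^ 6) +
        140 * ∑ k ∈ Icc 1 N, copTauW n k * Real.log (y / k) ^ c *
          ((∑ p ∈ k.primeFactors, Real.log p ^ 4) * ∑ p ∈ k.primeFactors, Real.log p ^ 4) -
        272 * ∑ k ∈ Icc 1 N, copTauW n k * Real.log (y / k) ^ c * ∑ p ∈ k.primeFactors, Real.log p ^ 8 := by
    rw [Finset.mul_sum, Finset.mul_sum, Finset.mul_sum, Finset.mul_sum, Finset.mul_sum, ← Finset.sum_sub_distrib,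
      ← Finset.sum_add_distrib, ← Finset.sum_add_distrib, ← Finset.sum_sub_distrib]
    exact Finset.sum_congr rfl fun k _ ↦ by ring
  rw [hlin]
  have key : ∀ S₁ S₂ S₃ S₄ S₅ : ℝ,
      105 * S₁ - 420 * S₂ + 448 * S₃ + 140 * S₄ - 272 * S₅ =
        105 * (S₁ + (2 * ((c : ℝ) * ((c : ℝ) - 1)) * (((Nat.factorial 7 : ℕ) : ℝ) * (c - 2).factorial / (c + 6).factorial) -
            (3 * (2 * (2 * ((c : ℝ) * ((c : ℝ) - 1)) * (((Nat.factorial 1 : ℕ) : ℝ) * (c - 2).factorial / (c).factorial)) *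
                (((Nat.factorial 5 : ℕ) : ℝ) * (c).factorial / (c + 6).factorial)) +
              3 * (2 * (8 * ((c.factorial : ℝ) / (c + 2).factorial)) *
                (((Nat.factorial 3 : ℕ) : ℝ) * (c + 2).factorial / (c + 6).factorial)) +
              2 * (176 * ((c.factorial : ℝ) / (c + 4).factorial)) *
                (((Nat.factorial 1 : ℕ) : ℝ) * (c + 4).factorial / (c + 6).factorial))) * mainConst n * Real.log y ^ (c + 6)) -
        420 * (S₂ + (2 * ((c : ℝ) * ((c : ℝ) - 1)) * (((Nat.factorial 7 : ℕ) : ℝ) * (c - 2).factorial / (c + 6).factorial) -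
            (2 * (2 * ((c : ℝ) * ((c : ℝ) - 1)) * (((Nat.factorial 3 : ℕ) : ℝ) * (c - 2).factorial / (c + 2).factorial)) *
                (((Nat.factorial 3 : ℕ) : ℝ) * (c + 2).factorial / (c + 6).factorial) +
              2 * (2 * ((c : ℝ) * ((c : ℝ) - 1)) * (((Nat.factorial 1 : ℕ) : ℝ) * (c - 2).factorial / (c).factorial)) *
                (((Nat.factorial 5 : ℕ) : ℝ) * (c).factorial / (c + 6).factorial) +
              2 * (216 * ((c.factorial : ℝ) / (c + 4).factorial)) *
                (((Nat.factorial 1 : ℕ) : ℝ) * (c + 4).factorial / (c + 6).factorial))) * mainConst n * Real.log y ^ (c + 6)) +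
        448 * (S₃ + (2 * ((c : ℝ) * ((c : ℝ) - 1)) * (((Nat.factorial 7 : ℕ) : ℝ) * (c - 2).factorial / (c + 6).factorial) -
            2 * (2 * ((c : ℝ) * ((c : ℝ) - 1)) * (((Nat.factorial 5 : ℕ) : ℝ) * (c - 2).factorial / (c + 4).factorial)) *
              (((Nat.factorial 1 : ℕ) : ℝ) * (c + 4).factorial / (c + 6).factorial)) * mainConst n * Real.log y ^ (c + 6)) +
        140 * (S₄ + (2 * ((c : ℝ) * ((c : ℝ) - 1)) * (((Nat.factorial 7 : ℕ) : ℝ) * (c - 2).factorial / (c + 6).factorial) -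
            2 * (2 * ((c : ℝ) * ((c : ℝ) - 1)) * (((Nat.factorial 3 : ℕ) : ℝ) * (c - 2).factorial / (c + 2).factorial)) *
              (((Nat.factorial 3 : ℕ) : ℝ) * (c + 2).factorial / (c + 6).factorial)) * mainConst n * Real.log y ^ (c + 6)) -
        272 * (S₅ + 2 * ((c : ℝ) * ((c : ℝ) - 1)) * (((Nat.factorial 7 : ℕ) : ℝ) * (c - 2).factorial / (c + 6).factorial) * mainConst n * Real.log y ^ (c + 6)) := by
    intro S₁ S₂ S₃ S₄ S₅
    linear_combination (-(mainConst n * Real.log y ^ (c + 6))) * hid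
  rw [key]
  refine (abs_comb_five_le _ _ _ _ _).trans ?_
  have hA' := mul_le_mul_of_nonneg_left hA (by norm_num : (0 : ℝ) ≤ 105)
  have hB' := mul_le_mul_of_nonneg_left hB (by norm_num : (0 : ℝ) ≤ 420)
  have hC' := mul_le_mul_of_nonneg_left hC (by norm_num : (0 : ℝ) ≤ 448)
  have hD' := mul_le_mul_of_nonneg_left hD (by norm_num : (0 : ℝ) ≤ 140)
  have hE' := mul_le_mul_of_nonneg_left hE (by norm_num : (0 : ℝ) ≤ 272)
  refine (add_le_add (add_le_add (add_le_add (add_le_add hA' hB') hC') hD') hE').trans_eq ?_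
  · ring

end Summit.Parity.GeneralizedHardyLittlewood.Theorems.MomentsBeyondDiagonal.DiagKernel

end
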